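import Summits.ResolutionOfSingularities.ResolutionOfSingularities.Theorems.FrobeniusLadderFInjectiveMacaulayficationTowerPersistenceKit
import Summits.ResolutionOfSingularities.ResolutionOfSingularities.Theorems.FrobeniusLadderFInjectiveMacaulayficationLx6q7PointFloor
import Summits.ResolutionOfSingularities.ResolutionOfSingularities.Theorems.FrobeniusLadderFInjectiveMacaulayficationLx6q7Specimen
import Summits.ResolutionOfSingularities.ResolutionOfSingularities.Theorems.FrobeniusLadderFInjectiveMacaulayficationHypersurfaceOriginNotFull
import Literature.AlgebraicGeometry.Resolution.AffineBlowupUnique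
import HarnessLib

/-!
# (L-f) THE CONDITIONAL KERNEL KILL OF TT-τ: `TauTowerConjecture` is FALSE as soon as the named chart data of the period-two cycle `L ⇄ M` are what the engines report
# (crux `FInjectiveMacaulayfication` stmt-ResolutionOfSingularities-15315, chain w45a; res-L1-w45a-plan-1 RULING R19.19 (L-f); seat res-L1-w45a-lead-1 g9; over lead-1's receivers
# `…TowerPersistenceKit` (p635381), res-L1-w45a-stub-2's `…IntrinsicTowerRecipes` (p632743) and res-L1-w45a-stub-3's floor package `…Lx6q7PointFloor` (p639147); ring identities credited to
# res-L1-w45a-idea-1 (Sketch-L1-idea-1-r23 §2, FB5-r7), independently replayed by res-L1-w45a-tri-2 g16)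

[OURS · L1 W4.5a] Support file (`--supports stmt-ResolutionOfSingularities-15315 --as helper`); NOT a statement of any manuscript; def-free, fact-free; §1–§2 UNCONDITIONAL; §3–§4 CONDITIONAL on
NAMED hypotheses spelled out in the binders (no smuggling): (hτL)/(hτM) the rad-τ centres of the two germs, (hloc) locality of `tauCentre` along open immersions, the two chart open immersions of
the cycle, and (§4) the occurrence chain. NOTHING here refutes `TauTowerConjecture` unconditionally — the decl stays `@[conjecture]`; this file only separates the KERNEL part of the refutation (tower
plumbing, receivers, ring identities, non-FULL origins) from the EVIDENCE part (test-ideal identifications on two hypersurface charts, the chart immersions, the floor-8 occurrence).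
AI-written (AI review is weaker than expert review).

THE GERMS (char 2; `X 0 = a`, `X 1 = b`, `X 2 = c`, `X 3 = d`, `X 4 = e`): `L = e² + a²ce + ac² + acd² + ab³c²`, `M = e² + a²ce + ac² + a²cd² + ab³c²`; `U_L = Spec k[X]/(L)`, `U_M = Spec k[X]/(M)`.
* §1 `L_chart_a` / `M_chart_a` — the KERNEL RING IDENTITIES of the cycle: under the chart-`a` substitution of the blowing up of `(a,c,d,e)` (resp. `(a,c,e)`), `L(a,b,ac,ad,ae) = a²·M` and
  `M(a,b,ac,d,ae) = a²·L` (`ring`; idea-1's `K_chart`/`G₂_chart_acde`/`G₂_chart_ace` at (j,k) = (1,1),(2,1)); `L_ne_zero`, `M_ne_zero`, `constantCoeff_L/M`, ★ `origin_L_not_fullCl` / `origin_M_not_fullCl`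
  (Fedder necessity: every monomial of `L`, `M` is divisible by the square of a variable — BOTH GERMS CARRY A NON-FULL POINT, unconditionally).
* §2 ★ `not_exists_tower_of_bad_prefix` (generic, kit namespace): a finite chain of blowing ups along the recipe's centres whose floors `0..m-1` each carry a non-`Q` point, ending at a floor
  with NO tower, has NO tower at floor `0` (the «prefix + loop» shape of every real certificate).
* §3 ★★ `not_exists_tauTower_of_cycle` — the 2-CYCLE RECEIVER INSTANTIATED: given (hτL) `tauCentre 2 U_L = (a,c,d,e)~`, (hτM) `tauCentre 2 U_M = (a,c,e)~`, (hloc), and the two chart open immersions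
  `U_M ⟶ Bl_{(a,c,d,e)} U_L`, `U_L ⟶ Bl_{(a,c,e)} U_M` (named: any blowing ups `BL`, `BM` with open immersions `jM`, `jL`), NO scheme containing an open copy of `U_L` has a rad-τ tower of any height
  ending FULL (`FullCentreDescent.not_exists_fullTower_of_recurrent_family₁`, `ι := Bool`).
* §4 ★★ `not_tauTowerConjecture_of_cycle_data` — with, in addition, the OCCURRENCE CHAIN from the admissible point floor of d4lx6q7 (a chain `F 0 ← F 1 ← … ← F 7` of blowing ups along `tauCentre`,
  `F 0` = a blowing up of `Spec 𝒪_{X,0}` along `𝔪̃` (stub-3's binders, p639147), floors `F 0..F 6` each with a non-FULL point, an open immersion `U_L ⟶ F 7`): `¬ TauTowerConjecture`.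
HONEST CAVEATS: the four data of §3/§4 are exactly what res-L1-w45a-idea-1 FB5-r7 and res-L1-w45a-tri-2's replay REPORT (τ(L) = (a,c,d,e), τ(M) = (a,c,e) by the Hochster–Huneke closure; the D(a)
charts; floor 8 ∋ L) — none of them is a tree theorem: test-ideal identification is not on FACT-LIST §A/§B (R19.7-DEFERRED-1), `tauCentre_local` is untyped, the chart immersions for a PARTIAL
coordinate centre on a hypersurface and the seven floors are typable but not typed here (named, as R19.19 allows). v41 is untouched; the crux is OPEN; v44 is HELD.
[folklore assembly; cite: GortzWedhorn2020, Prop. 13.91 (2); StacksProject, Tag 080B; Fedder1983, Prop. 1.7]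
-/

-- single-problem summit: the doubled namespace component is forced
set_option linter.dupNamespace false

noncomputable section

open AlgebraicGeometry CategoryTheory CategoryTheory.Limits Literature.AlgebraicGeometry.Resolution TopologicalSpace IsLocalRing MvPolynomial

/-! ## §2 (generic) A bad finite prefix followed by a tower-less floor -/

namespace Summit.ResolutionOfSingularities.ResolutionOfSingularities.Theorems.FInjectiveMacaulayfication.FullCentreDescent

open Summit.ResolutionOfSingularities.ResolutionOfSingularities.Theorems.FInjectiveMacaulayfication

/-- ★ **PREFIX LEMMA.** `T 0 ⇒ Q everywhere`, `T (n+1) S ⇒ T n` on every blowing up along `c S`. Given a chain `F 0 ← F 1 ← … ← F m` of blowing ups along the recipe's centres (`hg`) whose floors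
`F i`, `i < m`, each carry a non-`Q` point (`hbad`) and whose last floor has NO tower (`hend`), the first floor has no tower. Induction on `m` generalizing the chain. [folklore; OURS] -/
theorem not_exists_tower_of_bad_prefix (Q : (S : Scheme.{0}) → S → Prop) (T : ℕ → Scheme.{0} → Prop) (c : (S : Scheme.{0}) → S.IdealSheafData)
    (h0 : ∀ (S : Scheme.{0}), T 0 S → ∀ s : S, Q S s)
    (hsucc : ∀ (n : ℕ) (S : Scheme.{0}), T (n + 1) S → ∀ (S₁ : Scheme.{0}) (g : S₁ ⟶ S), IsBlowup g (c S) → T n S₁) :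
    ∀ (m : ℕ) (F : ℕ → Scheme.{0}) (g : ∀ i : ℕ, F (i + 1) ⟶ F i),
      (∀ i, i < m → IsBlowup (g i) (c (F i))) → (∀ i, i < m → ∃ s : F i, ¬ Q (F i) s) → (¬ ∃ n : ℕ, T n (F m)) →
      ¬ ∃ n : ℕ, T n (F 0) := by
  intro m
  induction m with
  | zero => intro F g _ _ hend; exact hend
  | succ m ih =>
    intro F g hg hbad hend ⟨n, hn⟩
    -- floor 0 is bad, so `n ≠ 0`
    obtain ⟨s, hs⟩ := hbad 0 (Nat.succ_pos m)
    cases n with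
    | zero => exact hs (h0 _ hn s)
    | succ n =>
      -- shift the chain by one and apply the induction hypothesis
      have h1 : T n (F 1) := hsucc n (F 0) hn (F 1) (g 0) (hg 0 (Nat.succ_pos m))
      refine ih (fun i => F (i + 1)) (fun i => g (i + 1)) (fun i hi => hg (i + 1) (by omega)) (fun i hi => hbad (i + 1) (by omega))
        (by simpa using hend) ⟨n, h1⟩

end Summit.ResolutionOfSingularities.ResolutionOfSingularities.Theorems.FInjectiveMacaulayfication.FullCentreDescent

namespace Summit.ResolutionOfSingularities.ResolutionOfSingularities.Theorems.FInjectiveMacaulayfication.RadTauLoopConditional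

open Summit.ResolutionOfSingularities.ResolutionOfSingularities.Theorems.FInjectiveMacaulayfication
open SliceableCentre IntrinsicTower IntrinsicTower.Recipes FullCentreDescent

/-! ## §1 The two germs: ring identities of the cycle, non-vanishing, non-FULL origins -/

/-- ★ **`L(a, b, ac, ad, ae) = a² · M`** — chart `D(a)` of the blowing up of `U_L` along `(a,c,d,e)` carries `M` (res-L1-w45a-idea-1 `G₂_chart_acde` at (j,k) = (1,1); `ring`). [OURS · kernel identity] -/
theorem L_chart_a (k : Type) [Field k] (L M : MvPolynomial (Fin 5) k)
    (hL : L = X 4 ^ 2 + X 0 ^ 2 * X 2 * X 4 + X 0 * X 2 ^ 2 + X 0 * X 2 * X 3 ^ 2 + X 0 * X 1 ^ 3 * X 2 ^ 2)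
    (hM : M = X 4 ^ 2 + X 0 ^ 2 * X 2 * X 4 + X 0 * X 2 ^ 2 + X 0 ^ 2 * X 2 * X 3 ^ 2 + X 0 * X 1 ^ 3 * X 2 ^ 2) :
    aeval (fun j : Fin 5 => if j = 0 ∨ j = 1 then (X j : MvPolynomial (Fin 5) k) else X j * X 0) L = X 0 ^ 2 * M := by
  subst hL; subst hM
  simp only [map_add, map_mul, map_pow, aeval_X]
  simp
  ring

/-- ★ **`M(a, b, ac, d, ae) = a² · L`** — chart `D(a)` of the blowing up of `U_M` along `(a,c,e)` carries `L` back (idea-1 `G₂_chart_ace` at (j,k) = (2,1) → (1,1); `ring`). [OURS · kernel identity] -/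
theorem M_chart_a (k : Type) [Field k] (L M : MvPolynomial (Fin 5) k)
    (hL : L = X 4 ^ 2 + X 0 ^ 2 * X 2 * X 4 + X 0 * X 2 ^ 2 + X 0 * X 2 * X 3 ^ 2 + X 0 * X 1 ^ 3 * X 2 ^ 2)
    (hM : M = X 4 ^ 2 + X 0 ^ 2 * X 2 * X 4 + X 0 * X 2 ^ 2 + X 0 ^ 2 * X 2 * X 3 ^ 2 + X 0 * X 1 ^ 3 * X 2 ^ 2) :
    aeval (fun j : Fin 5 => if j = 0 ∨ j = 1 ∨ j = 3 then (X j : MvPolynomial (Fin 5) k) else X j * X 0) M = X 0 ^ 2 * L := by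
  subst hL; subst hM
  simp only [map_add, map_mul, map_pow, aeval_X]
  simp
  ring

/-- `L ≠ 0` (`L(e = 1) = 1`). [plumbing] -/
theorem L_ne_zero (k : Type) [Field k] (L : MvPolynomial (Fin 5) k)
    (hL : L = X 4 ^ 2 + X 0 ^ 2 * X 2 * X 4 + X 0 * X 2 ^ 2 + X 0 * X 2 * X 3 ^ 2 + X 0 * X 1 ^ 3 * X 2 ^ 2) : L ≠ 0 := by
  intro h
  have := congrArg (MvPolynomial.eval (Pi.single 4 1 : Fin 5 → k)) h
  rw [hL] at this
  simp at this

/-- `M ≠ 0` (`M(e = 1) = 1`). [plumbing] -/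
theorem M_ne_zero (k : Type) [Field k] (M : MvPolynomial (Fin 5) k)
    (hM : M = X 4 ^ 2 + X 0 ^ 2 * X 2 * X 4 + X 0 * X 2 ^ 2 + X 0 ^ 2 * X 2 * X 3 ^ 2 + X 0 * X 1 ^ 3 * X 2 ^ 2) : M ≠ 0 := by
  intro h
  have := congrArg (MvPolynomial.eval (Pi.single 4 1 : Fin 5 → k)) h
  rw [hM] at this
  simp at this

/-- `L` has no constant term. [plumbing] -/
theorem constantCoeff_L (k : Type) [Field k] (L : MvPolynomial (Fin 5) k)
    (hL : L = X 4 ^ 2 + X 0 ^ 2 * X 2 * X 4 + X 0 * X 2 ^ 2 + X 0 * X 2 * X 3 ^ 2 + X 0 * X 1 ^ 3 * X 2 ^ 2) : constantCoeff L = 0 := by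
  rw [hL]; simp [constantCoeff_X]

/-- `M` has no constant term. [plumbing] -/
theorem constantCoeff_M (k : Type) [Field k] (M : MvPolynomial (Fin 5) k)
    (hM : M = X 4 ^ 2 + X 0 ^ 2 * X 2 * X 4 + X 0 * X 2 ^ 2 + X 0 ^ 2 * X 2 * X 3 ^ 2 + X 0 * X 1 ^ 3 * X 2 ^ 2) : constantCoeff M = 0 := by
  rw [hM]; simp [constantCoeff_X]

/-- `L ∈ 𝔫^{[2]} = (a², b², c², d², e²)`: every monomial of `L` is divisible by the square of a variable (Fedder; idea-1 `G₂_mem_bracket`). [certificate; cite: Fedder1983, Prop. 1.7] -/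
theorem L_mem_bracket (k : Type) [Field k] (L : MvPolynomial (Fin 5) k)
    (hL : L = X 4 ^ 2 + X 0 ^ 2 * X 2 * X 4 + X 0 * X 2 ^ 2 + X 0 * X 2 * X 3 ^ 2 + X 0 * X 1 ^ 3 * X 2 ^ 2) :
    L ^ (2 - 1) ∈ Ideal.span (Set.range fun i : Fin 5 => (X i : MvPolynomial (Fin 5) k) ^ 2) := by
  rw [show (2 - 1 : ℕ) = 1 from rfl, pow_one, hL]
  have hsq : ∀ j : Fin 5, (X j : MvPolynomial (Fin 5) k) ^ 2 ∈ Ideal.span (Set.range fun i : Fin 5 => (X i : MvPolynomial (Fin 5) k) ^ 2) :=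
    fun j => Ideal.subset_span ⟨j, rfl⟩
  refine Ideal.add_mem _ (Ideal.add_mem _ (Ideal.add_mem _ (Ideal.add_mem _ (hsq 4) ?_) ?_) ?_) ?_
  · rw [show (X 0 : MvPolynomial (Fin 5) k) ^ 2 * X 2 * X 4 = X 0 ^ 2 * (X 2 * X 4) by ring]
    exact Ideal.mul_mem_right _ _ (hsq 0)
  · rw [show (X 0 : MvPolynomial (Fin 5) k) * X 2 ^ 2 = X 2 ^ 2 * X 0 by ring]
    exact Ideal.mul_mem_right _ _ (hsq 2)
  · rw [show (X 0 : MvPolynomial (Fin 5) k) * X 2 * X 3 ^ 2 = X 3 ^ 2 * (X 0 * X 2) by ring]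
    exact Ideal.mul_mem_right _ _ (hsq 3)
  · rw [show (X 0 : MvPolynomial (Fin 5) k) * X 1 ^ 3 * X 2 ^ 2 = X 2 ^ 2 * (X 0 * X 1 ^ 3) by ring]
    exact Ideal.mul_mem_right _ _ (hsq 2)

/-- `M ∈ 𝔫^{[2]}`. [certificate; cite: Fedder1983, Prop. 1.7] -/
theorem M_mem_bracket (k : Type) [Field k] (M : MvPolynomial (Fin 5) k)
    (hM : M = X 4 ^ 2 + X 0 ^ 2 * X 2 * X 4 + X 0 * X 2 ^ 2 + X 0 ^ 2 * X 2 * X 3 ^ 2 + X 0 * X 1 ^ 3 * X 2 ^ 2) :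
    M ^ (2 - 1) ∈ Ideal.span (Set.range fun i : Fin 5 => (X i : MvPolynomial (Fin 5) k) ^ 2) := by
  rw [show (2 - 1 : ℕ) = 1 from rfl, pow_one, hM]
  have hsq : ∀ j : Fin 5, (X j : MvPolynomial (Fin 5) k) ^ 2 ∈ Ideal.span (Set.range fun i : Fin 5 => (X i : MvPolynomial (Fin 5) k) ^ 2) :=
    fun j => Ideal.subset_span ⟨j, rfl⟩
  refine Ideal.add_mem _ (Ideal.add_mem _ (Ideal.add_mem _ (Ideal.add_mem _ (hsq 4) ?_) ?_) ?_) ?_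
  · rw [show (X 0 : MvPolynomial (Fin 5) k) ^ 2 * X 2 * X 4 = X 0 ^ 2 * (X 2 * X 4) by ring]
    exact Ideal.mul_mem_right _ _ (hsq 0)
  · rw [show (X 0 : MvPolynomial (Fin 5) k) * X 2 ^ 2 = X 2 ^ 2 * X 0 by ring]
    exact Ideal.mul_mem_right _ _ (hsq 2)
  · rw [show (X 0 : MvPolynomial (Fin 5) k) ^ 2 * X 2 * X 3 ^ 2 = X 0 ^ 2 * (X 2 * X 3 ^ 2) by ring]
    exact Ideal.mul_mem_right _ _ (hsq 0)
  · rw [show (X 0 : MvPolynomial (Fin 5) k) * X 1 ^ 3 * X 2 ^ 2 = X 2 ^ 2 * (X 0 * X 1 ^ 3) by ring]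
    exact Ideal.mul_mem_right _ _ (hsq 2)

/-- ★ **A hypersurface germ `k[X]/(g)` with `g ≠ 0`, `g(0) = 0`, `g ∈ 𝔫^{[2]}` has a NON-FULL point (its origin).** [cite: Fedder1983, Prop. 1.7] -/
theorem exists_not_fullCl_of_fedder_mem (k : Type) [Field k] [CharP k 2] (g : MvPolynomial (Fin 5) k) (hg0 : g ≠ 0) (hc : constantCoeff g = 0)
    (hfed : g ^ (2 - 1) ∈ Ideal.span (Set.range fun i : Fin 5 => (X i : MvPolynomial (Fin 5) k) ^ 2)) :
    ∃ u : Spec (.of (MvPolynomial (Fin 5) k ⧸ Ideal.span {g})), ¬ FullCl 2 ((Spec (.of (MvPolynomial (Fin 5) k ⧸ Ideal.span {g}))).presheaf.stalk u) := by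
  haveI : Fact (Nat.Prime 2) := ⟨Nat.prime_two⟩
  haveI hmax : (Ideal.span (Set.range fun j : Fin 5 => Ideal.Quotient.mk (Ideal.span {g}) (X j))).IsMaximal :=
    DoublePointFermatCubicGerm.isMaximal_origin k g hc
  exact ⟨⟨_, hmax.isPrime⟩, HypersurfaceOriginNotFull.not_fullCl_stalk_origin_of_fedder_mem 2 k g hg0 hc hfed _ rfl⟩

/-! ## §3 ★★ The two-cycle receiver, instantiated at the rad-τ recipe -/

/-- ★★ **CONDITIONAL KILL, LOCAL FORM.** Let `L`, `M` be the two germs (char 2, any field). ASSUME (named, evidence-level data): (hτL) the rad-τ centre of `U_L` is `(a,c,d,e)~`; (hτM) that of `U_M`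
is `(a,c,e)~`; (hloc) `tauCentre 2` commutes with open immersions; (BL, πL, jM) a blowing up of `U_L` along `(a,c,d,e)~` receiving an open immersion from `U_M`; (BM, πM, jL) a blowing up of `U_M` along
`(a,c,e)~` receiving an open immersion from `U_L`. THEN no scheme containing an open copy of `U_L` has a rad-τ tower of ANY height ending FULL everywhere. LOAD-BEARING hypotheses: `hloc` and the two occurrence data (`πL` a blowing up ALONG
`tauCentre 2 U_L` receiving `jM`; `πM`, `jL` symmetrically); `hτL`/`hτM` are DOCUMENTARY ONLY (unused in the proof — they NAME the centres the engines report; the centre identification is implicit in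
the satisfiability of `jM`/`jL`, cf. res-L1-w45a-tri-2 lens (R1)/(R2)). [OURS · conditional; receivers p635381] -/
theorem not_exists_tauTower_of_cycle (k : Type) [Field k] [CharP k 2] (L M : MvPolynomial (Fin 5) k)
    (hL : L = X 4 ^ 2 + X 0 ^ 2 * X 2 * X 4 + X 0 * X 2 ^ 2 + X 0 * X 2 * X 3 ^ 2 + X 0 * X 1 ^ 3 * X 2 ^ 2)
    (hM : M = X 4 ^ 2 + X 0 ^ 2 * X 2 * X 4 + X 0 * X 2 ^ 2 + X 0 ^ 2 * X 2 * X 3 ^ 2 + X 0 * X 1 ^ 3 * X 2 ^ 2)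
    (hloc : ∀ {U S : Scheme.{0}} (j : U ⟶ S) [IsOpenImmersion j], (tauCentre 2 S).comap j = tauCentre 2 U)
    (hτL : tauCentre 2 (Spec (.of (MvPolynomial (Fin 5) k ⧸ Ideal.span {L}))) =
      affineBlowup.idealSheaf (Ideal.span ({Ideal.Quotient.mk (Ideal.span {L}) (X 0), Ideal.Quotient.mk (Ideal.span {L}) (X 2),
        Ideal.Quotient.mk (Ideal.span {L}) (X 3), Ideal.Quotient.mk (Ideal.span {L}) (X 4)} : Set (MvPolynomial (Fin 5) k ⧸ Ideal.span {L}))))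
    (hτM : tauCentre 2 (Spec (.of (MvPolynomial (Fin 5) k ⧸ Ideal.span {M}))) =
      affineBlowup.idealSheaf (Ideal.span ({Ideal.Quotient.mk (Ideal.span {M}) (X 0), Ideal.Quotient.mk (Ideal.span {M}) (X 2),
        Ideal.Quotient.mk (Ideal.span {M}) (X 4)} : Set (MvPolynomial (Fin 5) k ⧸ Ideal.span {M}))))
    (BL : Scheme.{0}) (πL : BL ⟶ Spec (.of (MvPolynomial (Fin 5) k ⧸ Ideal.span {L})))
    (hπL : IsBlowup πL (tauCentre 2 (Spec (.of (MvPolynomial (Fin 5) k ⧸ Ideal.span {L})))))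
    (jM : Spec (.of (MvPolynomial (Fin 5) k ⧸ Ideal.span {M})) ⟶ BL) [IsOpenImmersion jM]
    (BM : Scheme.{0}) (πM : BM ⟶ Spec (.of (MvPolynomial (Fin 5) k ⧸ Ideal.span {M})))
    (hπM : IsBlowup πM (tauCentre 2 (Spec (.of (MvPolynomial (Fin 5) k ⧸ Ideal.span {M})))))
    (jL : Spec (.of (MvPolynomial (Fin 5) k ⧸ Ideal.span {L})) ⟶ BM) [IsOpenImmersion jL]
    (S : Scheme.{0}) (hS : ∃ j : Spec (.of (MvPolynomial (Fin 5) k ⧸ Ideal.span {L})) ⟶ S, IsOpenImmersion j) :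
    ¬ ∃ n : ℕ, RecipeTowerFull tauCentre 2 n S := by
  -- silence the unused named identifications (they document WHICH centres the blow-ups `πL`, `πM` are along; the receiver only needs `IsBlowup … (tauCentre 2 _)`)
  have _ := hτL; have _ := hτM
  -- the Bool-indexed cycle: `false ↦ U_L`, `true ↦ U_M`
  let U : Bool → Scheme.{0} := fun b => Bool.rec (Spec (.of (MvPolynomial (Fin 5) k ⧸ Ideal.span {L}))) (Spec (.of (MvPolynomial (Fin 5) k ⧸ Ideal.span {M}))) b
  let B : Bool → Scheme.{0} := fun b => Bool.rec BL BM b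
  let π : ∀ b : Bool, B b ⟶ U b := fun b => match b with
    | false => πL
    | true => πM
  have hπ : ∀ b : Bool, IsBlowup (π b) (tauCentre 2 (U b)) := fun b => match b with
    | false => hπL
    | true => hπM
  let j : ∀ b : Bool, U (!b) ⟶ B b := fun b => match b with
    | false => jM
    | true => jL
  have hj : ∀ b : Bool, IsOpenImmersion (j b) := fun b => match b with
    | false => show IsOpenImmersion jM from inferInstance
    | true => show IsOpenImmersion jL from inferInstance
  have hU : ∀ b : Bool, ∃ u : U b, ¬ FullCl 2 ((U b).presheaf.stalk u) := fun b => match b with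
    | false => exists_not_fullCl_of_fedder_mem k L (L_ne_zero k L hL) (constantCoeff_L k L hL) (L_mem_bracket k L hL)
    | true => exists_not_fullCl_of_fedder_mem k M (M_ne_zero k M hM) (constantCoeff_M k M hM) (M_mem_bracket k M hM)
  exact not_exists_fullTower_of_recurrent_family₁ 2 (RecipeTowerFull tauCentre 2) (tauCentre 2) (fun _ h => h) (fun _ _ h => h)
    (fun j' _ => hloc j') U hU Bool.not B π hπ j hj S (by obtain ⟨j₀, hj₀⟩ := hS; exact ⟨false, j₀, hj₀⟩)

/-! ## §4 ★★ The conditional refutation of `TauTowerConjecture` -/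

/-- ★★ **CONDITIONAL KILL OF TT-τ.** With the data of §3 and, in addition, the OCCURRENCE CHAIN from the admissible point floor of d4lx6q7 (`X = {z² + x⁶z + y³ + u³ + t⁷}`, char 2): a chain
`F 0 ← F 1 ← … ← F 7` of blowing ups along the rad-τ centres (`hg`), `F 0` a blowing up of `Spec 𝒪_{X,0}` along `𝔪̃` (res-L1-w45a-stub-3's floor, p639147), floors `F 0, …, F 6` each with a
non-FULL point (`hbad`), and an open immersion `U_L ⟶ F 7` (`hocc`): `TauTowerConjecture` is FALSE. (At `F 0` the conjecture gives a height `n`; §2 pushes it past the bad prefix to `F 7`, where §3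
forbids it.) The five named data are exactly what res-L1-w45a-idea-1 FB5-r7 and res-L1-w45a-tri-2's disjoint replay report (floor 8 in tri-2's numbering = `F 7` here, floor 1 being `F 0`).
[OURS · CONDITIONAL refutation; nothing unconditional] -/
theorem not_tauTowerConjecture_of_cycle_data (k : Type) [Field k] [CharP k 2] (L M : MvPolynomial (Fin 5) k)
    (hL : L = X 4 ^ 2 + X 0 ^ 2 * X 2 * X 4 + X 0 * X 2 ^ 2 + X 0 * X 2 * X 3 ^ 2 + X 0 * X 1 ^ 3 * X 2 ^ 2)
    (hM : M = X 4 ^ 2 + X 0 ^ 2 * X 2 * X 4 + X 0 * X 2 ^ 2 + X 0 ^ 2 * X 2 * X 3 ^ 2 + X 0 * X 1 ^ 3 * X 2 ^ 2)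
    (hloc : ∀ {U S : Scheme.{0}} (j : U ⟶ S) [IsOpenImmersion j], (tauCentre 2 S).comap j = tauCentre 2 U)
    (hτL : tauCentre 2 (Spec (.of (MvPolynomial (Fin 5) k ⧸ Ideal.span {L}))) =
      affineBlowup.idealSheaf (Ideal.span ({Ideal.Quotient.mk (Ideal.span {L}) (X 0), Ideal.Quotient.mk (Ideal.span {L}) (X 2),
        Ideal.Quotient.mk (Ideal.span {L}) (X 3), Ideal.Quotient.mk (Ideal.span {L}) (X 4)} : Set (MvPolynomial (Fin 5) k ⧸ Ideal.span {L}))))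
    (hτM : tauCentre 2 (Spec (.of (MvPolynomial (Fin 5) k ⧸ Ideal.span {M}))) =
      affineBlowup.idealSheaf (Ideal.span ({Ideal.Quotient.mk (Ideal.span {M}) (X 0), Ideal.Quotient.mk (Ideal.span {M}) (X 2),
        Ideal.Quotient.mk (Ideal.span {M}) (X 4)} : Set (MvPolynomial (Fin 5) k ⧸ Ideal.span {M}))))
    (BL : Scheme.{0}) (πL : BL ⟶ Spec (.of (MvPolynomial (Fin 5) k ⧸ Ideal.span {L})))
    (hπL : IsBlowup πL (tauCentre 2 (Spec (.of (MvPolynomial (Fin 5) k ⧸ Ideal.span {L})))))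
    (jM : Spec (.of (MvPolynomial (Fin 5) k ⧸ Ideal.span {M})) ⟶ BL) [IsOpenImmersion jM]
    (BM : Scheme.{0}) (πM : BM ⟶ Spec (.of (MvPolynomial (Fin 5) k ⧸ Ideal.span {M})))
    (hπM : IsBlowup πM (tauCentre 2 (Spec (.of (MvPolynomial (Fin 5) k ⧸ Ideal.span {M})))))
    (jL : Spec (.of (MvPolynomial (Fin 5) k ⧸ Ideal.span {L})) ⟶ BM) [IsOpenImmersion jL]
    -- the occurrence chain from the point floor of d4lx6q7
    (f : MvPolynomial (Fin 5) k) (hf : f = X 4 ^ 2 + X 0 ^ 6 * X 4 + X 1 ^ 3 + X 2 ^ 3 + X 3 ^ 7)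
    (v : Spec (.of (MvPolynomial (Fin 5) k ⧸ Ideal.span {f})))
    (hv : v.asIdeal = Ideal.span (Set.range (fun j : Fin 5 => Ideal.Quotient.mk (Ideal.span {f}) (X j))))
    (F : ℕ → Scheme.{0}) (g : ∀ i : ℕ, F (i + 1) ⟶ F i)
    (g₀ : F 0 ⟶ Spec ((Spec (.of (MvPolynomial (Fin 5) k ⧸ Ideal.span {f}))).presheaf.stalk v))
    (hg₀ : IsBlowup g₀ ((affineBlowup.idealSheaf (Ideal.span (Set.range (fun j : Fin 5 => Ideal.Quotient.mk (Ideal.span {f}) (X j))))).comap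
      ((Spec (.of (MvPolynomial (Fin 5) k ⧸ Ideal.span {f}))).fromSpecStalk v)))
    (hg : ∀ i, i < 7 → IsBlowup (g i) (tauCentre 2 (F i)))
    (hbad : ∀ i, i < 7 → ∃ s : F i, ¬ FullCl 2 ((F i).presheaf.stalk s))
    (hocc : ∃ j : Spec (.of (MvPolynomial (Fin 5) k ⧸ Ideal.span {L})) ⟶ F 7, IsOpenImmersion j) :
    ¬ TauTowerConjecture := by
  intro hTT
  have hend : ¬ ∃ n : ℕ, RecipeTowerFull tauCentre 2 n (F 7) :=
    not_exists_tauTower_of_cycle k L M hL hM hloc hτL hτM BL πL hπL jM BM πM hπM jL (F 7) hocc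
  have h0 : ¬ ∃ n : ℕ, RecipeTowerFull tauCentre 2 n (F 0) :=
    not_exists_tower_of_bad_prefix (fun S s => FullCl 2 (S.presheaf.stalk s)) (RecipeTowerFull tauCentre 2) (tauCentre 2)
      (fun _ h => h) (fun _ _ h => h) 7 F g hg hbad hend
  exact h0 (Lx6q7PointFloor.tauTower_at_pointFloor hTT k f hf v hv (F 0) g₀ hg₀)

end Summit.ResolutionOfSingularities.ResolutionOfSingularities.Theorems.FInjectiveMacaulayfication.RadTauLoopConditional

end
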